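import Literature.Probability.Process.RenewalTheoremGeneral
import HarnessLib

/-!
# The delayed renewal theorem with a geometric rate (model-free)

Topic `Literature/Probability/Process`, continuing `RenewalTheoremGeneral.lean` (Madras–Slade Theorem
4.2.2 (b) for a general delay `g`: `Renewal.tendsto_sum_antidiagonal_mul` proves
`Σ_{j+i=n} g_j u_i → (Σ g) · L` from `u_i → L` by dominated convergence, WITHOUT a rate) and
`RenewalRate.lean` / `RenewalKendallRate.lean` (geometric rates `|u_n - 1/m| ≤ K ρ⁻ⁿ` for the
UNDELAYED renewal sequence). This file supplies the missing fourth corner: the rate of convergence of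
the delayed (convolved) sequence `v_n = Σ_{j+i=n} g_j u_i` to its limit `(Σ g) · L`, when the delay
`g` has a geometric envelope `|g_j| ≤ B θʲ` and `u` converges at a geometric rate `|u_i - L| ≤ A κⁱ`.

Source of the argument: N. Madras, G. Slade, *The Self-Avoiding Walk* (1993), Appendix B, proof of
Theorem B.1 (pp. 389–392 of the book), last paragraph ("apply the dominated convergence theorem to
(B.5)"): we replace dominated convergence by the explicit head–tail bookkeeping
`v_n - (Σ g) L = Σ_{j ≤ n} g_j (u_{n-j} - L) - (Σ_{j > n} g_j) L` (`sum_antidiagonal_mul_sub_tsum_mul`)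
and bound the two pieces separately; this is the standard route to rates in the delayed
renewal theorem, cf. W. Feller, *An Introduction to Probability Theory and its Applications* I
(3rd ed. 1968), XIII.5 (delayed recurrent events) and XIII.10 (the renewal equation with
geometric tails).

Main statements (namespace `Literature.Probability.Process.Renewal`, variables `g u : ℕ → ℝ`):
* `sum_antidiagonal_mul_sub_tsum_mul` — the head–tail identity (needs only `Summable g`);
* `abs_sum_antidiagonal_mul_sub_le_of_geometric` — `|v_n - (Σ g) L| ≤ (A B (n+1) + B θ |L| / (1-θ)) κⁿ`
  for `0 ≤ θ ≤ κ < 1`;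
* `abs_sum_antidiagonal_mul_sub_le_of_geometric_lt` — the pure geometric form
  `≤ (A B κ / (κ - θ) + B θ |L| / (1-θ)) κⁿ` when `θ < κ`;
* `succ_mul_pow_le_inv_one_sub` — `(n+1) tⁿ ≤ 1/(1-t)` for `0 ≤ t < 1`, and with it
  `exists_geometric_of_linear_geometric` — a bound `C (n+1) κⁿ` is a bound `C' κ'ⁿ` for every
  `κ < κ' < 1` (absorbing the linear factor);
* `sum_range_mul_sub_tsum_mul`, `abs_sum_range_mul_sub_le_of_geometric` — the same in the `range`
  spelling `v_n = Σ_{k < n+1} g_k u_{n-k}` used by the tree's renewal identities.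

Model instance already in the lane's pool: the wall-bridge amplitudes of adsorbed honeycomb surface
walks (`SAW.HexBW.Wall.abs_wbAmp_sub_lim_le` in `HexSAWSurfaceWallDelayedRenewal.lean` is this bound
computed inline for `g = dwbLaw y`, `u = pwbAmp y`); the present file is the model-free statement.
-/

noncomputable section

open Finset Filter Topology

namespace Literature.Probability.Process.Renewal

variable {g u : ℕ → ℝ}

/-! ### The head–tail identity -/

/-- **Head–tail decomposition of the delayed sequence** (replacing M–S's appeal to dominated
convergence by explicit bookkeeping): for a summable delay `g`,
`Σ_{j+i=n} g_j u_i - (Σ g) L = Σ_{k ≤ n} g_k (u_{n-k} - L) - (Σ_{j ≥ n+1} g_j) L`.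
[cite: MadrasSlade1993, Appendix B, proof of Theorem B.1, last paragraph (pp. 391-392)] -/
theorem sum_antidiagonal_mul_sub_tsum_mul (hgs : Summable g) (L : ℝ) (n : ℕ) :
    ∑ p ∈ antidiagonal n, g p.1 * u p.2 - (∑' j, g j) * L =
      ∑ k ∈ range (n + 1), g k * (u (n - k) - L) - (∑' j, g (j + (n + 1))) * L := by
  rw [Finset.Nat.sum_antidiagonal_eq_sum_range_succ (fun i j => g i * u j) n,
    ← hgs.sum_add_tsum_nat_add (n + 1)]
  simp only [Nat.succ_eq_add_one, mul_sub, Finset.sum_sub_distrib, add_mul, Finset.sum_mul]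
  ring

/-- The `range` spelling of `sum_antidiagonal_mul_sub_tsum_mul`:
`Σ_{k < n+1} g_k u_{n-k} - (Σ g) L = Σ_{k < n+1} g_k (u_{n-k} - L) - (Σ_{j ≥ n+1} g_j) L`.
[cite: MadrasSlade1993, Appendix B, proof of Theorem B.1, last paragraph (pp. 391-392)] -/
theorem sum_range_mul_sub_tsum_mul (hgs : Summable g) (L : ℝ) (n : ℕ) :
    ∑ k ∈ range (n + 1), g k * u (n - k) - (∑' j, g j) * L =
      ∑ k ∈ range (n + 1), g k * (u (n - k) - L) - (∑' j, g (j + (n + 1))) * L := by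
  rw [← sum_antidiagonal_mul_sub_tsum_mul hgs L n,
    Finset.Nat.sum_antidiagonal_eq_sum_range_succ (fun i j => g i * u j) n]

/-! ### Geometric envelopes give a geometric rate -/

/-- A geometric envelope `|g_j| ≤ B θʲ` with `0 ≤ θ < 1` makes `g` summable.
[cite: Feller1968, XIII.10 (generating functions with radius of convergence > 1)] -/
theorem summable_of_delay_envelope {B θ : ℝ} (hθ0 : 0 ≤ θ) (hθ1 : θ < 1)
    (hg : ∀ j, |g j| ≤ B * θ ^ j) : Summable g :=
  Summable.of_norm_bounded ((summable_geometric_of_lt_one hθ0 hθ1).mul_left B)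
    fun j => by simpa only [Real.norm_eq_abs] using hg j

/-- Tail of a geometrically enveloped sequence: `|Σ_{j ≥ n+1} g_j| ≤ B θⁿ⁺¹ / (1 - θ)`.
[cite: Feller1968, XIII.10 (generating functions with radius of convergence > 1)] -/
theorem abs_tsum_delay_tail_le {B θ : ℝ} (hθ0 : 0 ≤ θ) (hθ1 : θ < 1)
    (hg : ∀ j, |g j| ≤ B * θ ^ j) (n : ℕ) :
    |∑' j, g (j + (n + 1))| ≤ B * θ ^ (n + 1) / (1 - θ) := by
  have hs : Summable fun j : ℕ => B * θ ^ (n + 1) * θ ^ j :=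
    (summable_geometric_of_lt_one hθ0 hθ1).mul_left _
  have hle : ∀ j, ‖g (j + (n + 1))‖ ≤ B * θ ^ (n + 1) * θ ^ j := fun j => by
    rw [Real.norm_eq_abs]
    calc |g (j + (n + 1))| ≤ B * θ ^ (j + (n + 1)) := hg _
      _ = B * θ ^ (n + 1) * θ ^ j := by rw [pow_add]; ring
  calc |∑' j, g (j + (n + 1))| = ‖∑' j, g (j + (n + 1))‖ := (Real.norm_eq_abs _).symm
    _ ≤ ∑' j : ℕ, B * θ ^ (n + 1) * θ ^ j := tsum_of_norm_bounded hs.hasSum hle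
    _ = B * θ ^ (n + 1) * (1 - θ)⁻¹ := by rw [tsum_mul_left, tsum_geometric_of_lt_one hθ0 hθ1]
    _ = B * θ ^ (n + 1) / (1 - θ) := by rw [div_eq_mul_inv]

/-- Head of the convolution: if `|g_k| ≤ B θᵏ`, `|u_i - L| ≤ A κⁱ` and `0 ≤ θ ≤ κ`, then
`|Σ_{k ≤ n} g_k (u_{n-k} - L)| ≤ A B (n+1) κⁿ`.
[cite: MadrasSlade1993, Appendix B, proof of Theorem B.1 (pp. 391-392); Feller1968, XIII.10] -/
theorem abs_sum_range_mul_sub_le_of_geometric_head {A B θ κ L : ℝ} (hθ0 : 0 ≤ θ) (hθκ : θ ≤ κ)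
    (hg : ∀ j, |g j| ≤ B * θ ^ j) (hu : ∀ i, |u i - L| ≤ A * κ ^ i) (n : ℕ) :
    |∑ k ∈ range (n + 1), g k * (u (n - k) - L)| ≤ A * B * (n + 1) * κ ^ n := by
  have hκ0 : 0 ≤ κ := hθ0.trans hθκ
  have hA : 0 ≤ A := by
    have h := hu 0
    rw [pow_zero, mul_one] at h
    exact (abs_nonneg _).trans h
  have hB : 0 ≤ B := by
    have h := hg 0
    rw [pow_zero, mul_one] at h
    exact (abs_nonneg _).trans h
  calc |∑ k ∈ range (n + 1), g k * (u (n - k) - L)|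
        ≤ ∑ k ∈ range (n + 1), |g k * (u (n - k) - L)| := Finset.abs_sum_le_sum_abs _ _
    _ ≤ ∑ k ∈ range (n + 1), A * B * κ ^ n := Finset.sum_le_sum fun k hk => by
        have hkn : k ≤ n := Nat.lt_succ_iff.1 (mem_range.1 hk)
        rw [abs_mul]
        calc |g k| * |u (n - k) - L| ≤ (B * θ ^ k) * (A * κ ^ (n - k)) :=
              mul_le_mul (hg k) (hu _) (abs_nonneg _) ((abs_nonneg _).trans (hg k))
          _ ≤ (B * κ ^ k) * (A * κ ^ (n - k)) :=
              mul_le_mul_of_nonneg_right (mul_le_mul_of_nonneg_left (pow_le_pow_left₀ hθ0 hθκ k) hB)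
                (mul_nonneg hA (pow_nonneg hκ0 _))
          _ = A * B * κ ^ n := by
              rw [show κ ^ n = κ ^ k * κ ^ (n - k) by rw [← pow_add, Nat.add_sub_cancel' hkn]]
              ring
    _ = A * B * (n + 1) * κ ^ n := by
        rw [Finset.sum_const, card_range, nsmul_eq_mul]
        push_cast
        ring

/-- **Delayed renewal theorem with a geometric rate.** If the delay has a geometric envelope
`|g_j| ≤ B θʲ` and the renewal sequence converges geometrically, `|u_i - L| ≤ A κⁱ`, with
`0 ≤ θ ≤ κ < 1`, then the delayed sequence `v_n = Σ_{j+i=n} g_j u_i` satisfies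
`|v_n - (Σ g) L| ≤ (A B (n+1) + B θ |L| / (1-θ)) κⁿ`.
[cite: MadrasSlade1993, Appendix B, proof of Theorem B.1, last paragraph (pp. 391-392); Feller1968, XIII.5 and XIII.10] -/
theorem abs_sum_antidiagonal_mul_sub_le_of_geometric {A B θ κ L : ℝ} (hθ0 : 0 ≤ θ) (hθκ : θ ≤ κ)
    (hκ1 : κ < 1) (hg : ∀ j, |g j| ≤ B * θ ^ j) (hu : ∀ i, |u i - L| ≤ A * κ ^ i) (n : ℕ) :
    |∑ p ∈ antidiagonal n, g p.1 * u p.2 - (∑' j, g j) * L| ≤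
      (A * B * (n + 1) + B * θ / (1 - θ) * |L|) * κ ^ n := by
  have hθ1 : θ < 1 := lt_of_le_of_lt hθκ hκ1
  have hB : 0 ≤ B := by
    have h := hg 0
    rw [pow_zero, mul_one] at h
    exact (abs_nonneg _).trans h
  have hgs : Summable g := summable_of_delay_envelope hθ0 hθ1 hg
  rw [sum_antidiagonal_mul_sub_tsum_mul hgs L n]
  have hhead := abs_sum_range_mul_sub_le_of_geometric_head hθ0 hθκ hg hu n
  have htail : |(∑' j, g (j + (n + 1))) * L| ≤ B * θ / (1 - θ) * |L| * κ ^ n := by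
    rw [abs_mul]
    calc |∑' j, g (j + (n + 1))| * |L| ≤ B * θ ^ (n + 1) / (1 - θ) * |L| :=
          mul_le_mul_of_nonneg_right (abs_tsum_delay_tail_le hθ0 hθ1 hg n) (abs_nonneg _)
      _ = B * θ / (1 - θ) * |L| * θ ^ n := by rw [pow_succ]; ring
      _ ≤ B * θ / (1 - θ) * |L| * κ ^ n := by
          have hc : 0 ≤ B * θ / (1 - θ) * |L| :=
            mul_nonneg (div_nonneg (mul_nonneg hB hθ0) (by linarith)) (abs_nonneg _)
          exact mul_le_mul_of_nonneg_left (pow_le_pow_left₀ hθ0 hθκ n) hc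
  calc |∑ k ∈ range (n + 1), g k * (u (n - k) - L) - (∑' j, g (j + (n + 1))) * L|
        ≤ |∑ k ∈ range (n + 1), g k * (u (n - k) - L)| + |(∑' j, g (j + (n + 1))) * L| :=
          abs_sub _ _
    _ ≤ A * B * (n + 1) * κ ^ n + B * θ / (1 - θ) * |L| * κ ^ n := add_le_add hhead htail
    _ = (A * B * (n + 1) + B * θ / (1 - θ) * |L|) * κ ^ n := by ring

/-- The `range` spelling of `abs_sum_antidiagonal_mul_sub_le_of_geometric`:
`|Σ_{k < n+1} g_k u_{n-k} - (Σ g) L| ≤ (A B (n+1) + B θ |L| / (1-θ)) κⁿ`.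
[cite: MadrasSlade1993, Appendix B, proof of Theorem B.1, last paragraph (pp. 391-392); Feller1968, XIII.5 and XIII.10] -/
theorem abs_sum_range_mul_sub_le_of_geometric {A B θ κ L : ℝ} (hθ0 : 0 ≤ θ) (hθκ : θ ≤ κ)
    (hκ1 : κ < 1) (hg : ∀ j, |g j| ≤ B * θ ^ j) (hu : ∀ i, |u i - L| ≤ A * κ ^ i) (n : ℕ) :
    |∑ k ∈ range (n + 1), g k * u (n - k) - (∑' j, g j) * L| ≤
      (A * B * (n + 1) + B * θ / (1 - θ) * |L|) * κ ^ n := by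
  rw [← Finset.Nat.sum_antidiagonal_eq_sum_range_succ (fun i j => g i * u j) n]
  exact abs_sum_antidiagonal_mul_sub_le_of_geometric hθ0 hθκ hκ1 hg hu n

/-- **Pure geometric form under separated ratios.** If moreover `θ < κ`, the head is itself
geometric: `Σ_{k ≤ n} B θᵏ A κⁿ⁻ᵏ ≤ A B κⁿ · κ/(κ-θ)`, so that
`|v_n - (Σ g) L| ≤ (A B κ / (κ - θ) + B θ |L| / (1-θ)) κⁿ` with no linear factor.
[cite: Feller1968, XIII.10 (partial fractions: the dominant singularity gives the rate); MadrasSlade1993, Appendix B, proof of Theorem B.1 (pp. 391-392)] -/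
theorem abs_sum_antidiagonal_mul_sub_le_of_geometric_lt {A B θ κ L : ℝ} (hθ0 : 0 ≤ θ) (hθκ : θ < κ)
    (hκ1 : κ < 1) (hg : ∀ j, |g j| ≤ B * θ ^ j) (hu : ∀ i, |u i - L| ≤ A * κ ^ i) (n : ℕ) :
    |∑ p ∈ antidiagonal n, g p.1 * u p.2 - (∑' j, g j) * L| ≤
      (A * B * κ / (κ - θ) + B * θ / (1 - θ) * |L|) * κ ^ n := by
  have hθ1 : θ < 1 := hθκ.trans hκ1
  have hκ0 : 0 < κ := hθ0.trans_lt hθκ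
  have hB : 0 ≤ B := by
    have h := hg 0
    rw [pow_zero, mul_one] at h
    exact (abs_nonneg _).trans h
  have hA : 0 ≤ A := by
    have h := hu 0
    rw [pow_zero, mul_one] at h
    exact (abs_nonneg _).trans h
  have hgs : Summable g := summable_of_delay_envelope hθ0 hθ1 hg
  rw [sum_antidiagonal_mul_sub_tsum_mul hgs L n]
  -- the ratio `t = θ/κ ∈ [0,1)`
  set t := θ / κ with ht
  have ht0 : 0 ≤ t := div_nonneg hθ0 hκ0.le
  have ht1 : t < 1 := (div_lt_one hκ0).2 hθκ
  have hθt : θ = t * κ := by rw [ht]; field_simp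
  have hhead : |∑ k ∈ range (n + 1), g k * (u (n - k) - L)| ≤ A * B * κ / (κ - θ) * κ ^ n := by
    calc |∑ k ∈ range (n + 1), g k * (u (n - k) - L)|
          ≤ ∑ k ∈ range (n + 1), |g k * (u (n - k) - L)| := Finset.abs_sum_le_sum_abs _ _
      _ ≤ ∑ k ∈ range (n + 1), A * B * κ ^ n * t ^ k := Finset.sum_le_sum fun k hk => by
          have hkn : k ≤ n := Nat.lt_succ_iff.1 (mem_range.1 hk)
          rw [abs_mul]
          calc |g k| * |u (n - k) - L| ≤ (B * θ ^ k) * (A * κ ^ (n - k)) :=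
                mul_le_mul (hg k) (hu _) (abs_nonneg _) ((abs_nonneg _).trans (hg k))
            _ = A * B * κ ^ n * t ^ k := by
                rw [hθt, mul_pow, show κ ^ n = κ ^ k * κ ^ (n - k) by
                  rw [← pow_add, Nat.add_sub_cancel' hkn]]
                ring
      _ = A * B * κ ^ n * ∑ k ∈ range (n + 1), t ^ k := by rw [Finset.mul_sum]
      _ ≤ A * B * κ ^ n * (1 - t)⁻¹ := by
          have hs := summable_geometric_of_lt_one ht0 ht1
          have hle : ∑ k ∈ range (n + 1), t ^ k ≤ ∑' k, t ^ k :=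
            hs.sum_le_tsum (range (n + 1)) fun k _ => pow_nonneg ht0 k
          rw [tsum_geometric_of_lt_one ht0 ht1] at hle
          exact mul_le_mul_of_nonneg_left hle (mul_nonneg (mul_nonneg hA hB) (pow_nonneg hκ0.le n))
      _ = A * B * κ / (κ - θ) * κ ^ n := by
          have hκθ : κ - θ ≠ 0 := sub_ne_zero.2 (ne_of_gt hθκ)
          have h1t : (1 - t) = (κ - θ) / κ := by rw [ht]; field_simp
          rw [h1t, inv_div]
          field_simp
  have htail : |(∑' j, g (j + (n + 1))) * L| ≤ B * θ / (1 - θ) * |L| * κ ^ n := by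
    rw [abs_mul]
    calc |∑' j, g (j + (n + 1))| * |L| ≤ B * θ ^ (n + 1) / (1 - θ) * |L| :=
          mul_le_mul_of_nonneg_right (abs_tsum_delay_tail_le hθ0 hθ1 hg n) (abs_nonneg _)
      _ = B * θ / (1 - θ) * |L| * θ ^ n := by rw [pow_succ]; ring
      _ ≤ B * θ / (1 - θ) * |L| * κ ^ n := by
          have hc : 0 ≤ B * θ / (1 - θ) * |L| :=
            mul_nonneg (div_nonneg (mul_nonneg hB hθ0) (by linarith)) (abs_nonneg _)
          exact mul_le_mul_of_nonneg_left (pow_le_pow_left₀ hθ0 hθκ.le n) hc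
  calc |∑ k ∈ range (n + 1), g k * (u (n - k) - L) - (∑' j, g (j + (n + 1))) * L|
        ≤ |∑ k ∈ range (n + 1), g k * (u (n - k) - L)| + |(∑' j, g (j + (n + 1))) * L| :=
          abs_sub _ _
    _ ≤ A * B * κ / (κ - θ) * κ ^ n + B * θ / (1 - θ) * |L| * κ ^ n := add_le_add hhead htail
    _ = (A * B * κ / (κ - θ) + B * θ / (1 - θ) * |L|) * κ ^ n := by ring

/-! ### Absorbing the linear factor -/

/-- `(n+1) tⁿ ≤ 1/(1-t)` for `0 ≤ t < 1` (since `(n+1) tⁿ ≤ Σ_{k ≤ n} tᵏ ≤ Σ tᵏ = 1/(1-t)`).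
[cite: Feller1968, XIII.10 (elementary majorisation of `n tⁿ` by a geometric series)] -/
private theorem succ_mul_pow_le_inv_one_sub {t : ℝ} (ht0 : 0 ≤ t) (ht1 : t < 1) (n : ℕ) :
    ((n : ℝ) + 1) * t ^ n ≤ 1 / (1 - t) := by
  have hs := summable_geometric_of_lt_one ht0 ht1
  have h1 : ((n : ℝ) + 1) * t ^ n ≤ ∑ k ∈ range (n + 1), t ^ k := by
    have : ∀ k ∈ range (n + 1), t ^ n ≤ t ^ k := fun k hk =>
      pow_le_pow_of_le_one ht0 ht1.le (Nat.lt_succ_iff.1 (mem_range.1 hk))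
    calc ((n : ℝ) + 1) * t ^ n = ∑ _k ∈ range (n + 1), t ^ n := by
          rw [Finset.sum_const, card_range, nsmul_eq_mul]; push_cast; ring
      _ ≤ ∑ k ∈ range (n + 1), t ^ k := Finset.sum_le_sum this
  have h2 : ∑ k ∈ range (n + 1), t ^ k ≤ ∑' k, t ^ k :=
    hs.sum_le_tsum (range (n + 1)) fun k _ => pow_nonneg ht0 k
  rw [tsum_geometric_of_lt_one ht0 ht1] at h2
  rw [one_div]
  exact h1.trans h2

/-- **Absorbing the linear factor.** A bound `|a_n| ≤ C (n+1) κⁿ` with `0 ≤ κ < κ' ` and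
`0 < κ'` is a bound `|a_n| ≤ (C κ' / (κ' - κ)) κ'ⁿ`: write `κ = t κ'` with `t = κ/κ' ∈ [0,1)` and
use `(n+1) tⁿ ≤ 1/(1-t) = κ'/(κ'-κ)`.
[cite: Feller1968, XIII.10 (elementary majorisation of `n tⁿ` by a geometric series)] -/
theorem abs_le_geometric_of_linear_geometric {a : ℕ → ℝ} {C κ κ' : ℝ} (hκ0 : 0 ≤ κ)
    (hκκ' : κ < κ') (ha : ∀ n, |a n| ≤ C * ((n : ℝ) + 1) * κ ^ n) (n : ℕ) :
    |a n| ≤ C * κ' / (κ' - κ) * κ' ^ n := by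
  have hκ'0 : 0 < κ' := hκ0.trans_lt hκκ'
  have hC : 0 ≤ C := by
    have h := ha 0
    simp only [Nat.cast_zero, zero_add, mul_one, pow_zero] at h
    exact (abs_nonneg _).trans h
  set t := κ / κ' with ht
  have ht0 : 0 ≤ t := div_nonneg hκ0 hκ'0.le
  have ht1 : t < 1 := (div_lt_one hκ'0).2 hκκ'
  have hκt : κ = t * κ' := by rw [ht]; field_simp
  have h1t : 1 / (1 - t) = κ' / (κ' - κ) := by
    have hne : κ' - κ ≠ 0 := sub_ne_zero.2 (ne_of_gt hκκ')
    rw [ht]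
    field_simp
  calc |a n| ≤ C * ((n : ℝ) + 1) * κ ^ n := ha n
    _ = C * (((n : ℝ) + 1) * t ^ n) * κ' ^ n := by rw [hκt, mul_pow]; ring
    _ ≤ C * (1 / (1 - t)) * κ' ^ n :=
        mul_le_mul_of_nonneg_right
          (mul_le_mul_of_nonneg_left (succ_mul_pow_le_inv_one_sub ht0 ht1 n) hC)
          (pow_nonneg hκ'0.le n)
    _ = C * κ' / (κ' - κ) * κ' ^ n := by rw [h1t]; ring

/-- Existential form of `abs_le_geometric_of_linear_geometric`: a linear-times-geometric bound with
ratio `κ ∈ [0,1)` is a geometric bound with some ratio `κ' ∈ (0,1)` (take `κ' = (1+κ)/2`).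
[cite: Feller1968, XIII.10 (elementary majorisation of `n tⁿ` by a geometric series)] -/
theorem exists_geometric_of_linear_geometric {a : ℕ → ℝ} {C κ : ℝ} (hκ0 : 0 ≤ κ) (hκ1 : κ < 1)
    (ha : ∀ n, |a n| ≤ C * ((n : ℝ) + 1) * κ ^ n) :
    ∃ κ' : ℝ, 0 < κ' ∧ κ' < 1 ∧ ∃ C' : ℝ, ∀ n, |a n| ≤ C' * κ' ^ n :=
  ⟨(1 + κ) / 2, by linarith, by linarith, C * ((1 + κ) / 2) / ((1 + κ) / 2 - κ),
    abs_le_geometric_of_linear_geometric hκ0 (by linarith) ha⟩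

/-- **Delayed renewal theorem with a geometric rate, existential form.** Under a geometric envelope
on the delay and a geometric rate for `u` (`0 ≤ θ ≤ κ < 1`), the delayed sequence converges to
`(Σ g) L` at SOME geometric rate `κ' ∈ (0,1)`.
[cite: MadrasSlade1993, Appendix B, proof of Theorem B.1, last paragraph (pp. 391-392); Feller1968, XIII.5 and XIII.10] -/
theorem exists_geometric_rate_sum_antidiagonal_mul {A B θ κ L : ℝ} (hθ0 : 0 ≤ θ) (hθκ : θ ≤ κ)
    (hκ1 : κ < 1) (hg : ∀ j, |g j| ≤ B * θ ^ j) (hu : ∀ i, |u i - L| ≤ A * κ ^ i) :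
    ∃ κ' : ℝ, 0 < κ' ∧ κ' < 1 ∧ ∃ C' : ℝ, ∀ n,
      |∑ p ∈ antidiagonal n, g p.1 * u p.2 - (∑' j, g j) * L| ≤ C' * κ' ^ n := by
  have hκ0 : 0 ≤ κ := hθ0.trans hθκ
  have hθ1 : θ < 1 := lt_of_le_of_lt hθκ hκ1
  have hB : 0 ≤ B := by
    have h := hg 0
    rw [pow_zero, mul_one] at h
    exact (abs_nonneg _).trans h
  have hD : 0 ≤ B * θ / (1 - θ) * |L| :=
    mul_nonneg (div_nonneg (mul_nonneg hB hθ0) (by linarith)) (abs_nonneg _)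
  refine exists_geometric_of_linear_geometric (C := A * B + B * θ / (1 - θ) * |L|) hκ0 hκ1 fun n => ?_
  calc |∑ p ∈ antidiagonal n, g p.1 * u p.2 - (∑' j, g j) * L|
        ≤ (A * B * (n + 1) + B * θ / (1 - θ) * |L|) * κ ^ n :=
          abs_sum_antidiagonal_mul_sub_le_of_geometric hθ0 hθκ hκ1 hg hu n
    _ ≤ (A * B * (n + 1) + B * θ / (1 - θ) * |L| * ((n : ℝ) + 1)) * κ ^ n := by
        have h1 : (1 : ℝ) ≤ (n : ℝ) + 1 := le_add_of_nonneg_left (Nat.cast_nonneg n)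
        exact mul_le_mul_of_nonneg_right (add_le_add le_rfl (le_mul_of_one_le_right hD h1))
          (pow_nonneg hκ0 n)
    _ = (A * B + B * θ / (1 - θ) * |L|) * ((n : ℝ) + 1) * κ ^ n := by ring

end Literature.Probability.Process.Renewal

end
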